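import Mathlib.RingTheory.Int.Basic
import Mathlib.Data.Int.Lemmas
import Mathlib.Data.ZMod.Basic
import Mathlib.Tactic
import HarnessLib

/-!
# The equation `x⁴ + 2y⁴ = z²` (Cohen, Prop. 6.5.4) and `x² + 2y² = z²` (Cor. 6.3.14 (1))

H. Cohen, *Number Theory I* (GTM 239) [Cohen2007NumberTheoryI]: Corollary 6.3.14 (1) (the coprime
integral solutions of `x² + 2y² = z²` are `x = ±(s² − 2t²)`, `y = 2st`, `z = ±(s² + 2t²)` with
`gcd(s,t) = 1`, `s` odd) and Proposition 6.5.4 (`x⁴ + 2y⁴ = z²` has no solution with `y ≠ 0`), by the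
printed descent. Everything here is a `theorem`.

## The printed proof and this file

* `sq_add_two_sq_eq_sq` (Cor. 6.3.14 (1) for `p = 2`, the part used later: the shape of `x` and `y`).
  Cohen derives it from the parametrization of conics (Cor. 6.3.6); we give the direct elementary
  argument: `y` is even (squares mod 8), `x, z` odd, `8w² = (z − x)(z + x)` with `(z ∓ x)/2` coprime,
  so `{(z − x)/2, (z + x)/2} = {±s², ±2t²}` (`Int.sq_of_isCoprime`).
* `quartic_add_two_quartic_ne_sq` (Prop. 6.5.4), proof as printed: from `x⁴ + 2y⁴ = z²` with
  `gcd(x,y) = 1`, `x² = ±(s² − 2t²)`, `y² = 2st`, so `s = ±u²`, `t = ±2v²`, `x² = ±(u⁴ − 8v⁴)`; the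
  sign `−` is impossible mod 8; the sign `+` gives `x² + 2(2v²)² = (u²)²`, hence `2v² = 2ab`,
  `u² = a² + 2b²`, `a = ±c²`, `b = ±d²`, and `c⁴ + 2d⁴ = u²` with `|u| < |z|` — descent on `|z|`.

Mathlib/tree search: `lean search 'x \^ 4 \+ 2 \* y \^ 4|\^ 4 \+ 2 \* [a-z] \^ 4 = [a-z] \^ 2'` — nothing;
Mathlib has `x⁴ + y⁴ ≠ z²` (`not_fermat_42`) and the tree `x⁴ − y⁴ = z²`
(`QuarticSumAndDifferenceEqCube.lean` and relatives), whose style (`Int.sq_of_isCoprime`, descent on a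
natural-number measure) is followed here.
-/

namespace Literature.NumberTheory.DiophantineGeometry

namespace QuarticAddTwiceQuartic

/-- Squares modulo 8: in `x² + 2y² = z²` with `y` odd there is no solution. [folklore] -/
private theorem zmod8_y_even : ∀ X Y Z : ZMod 8, X ^ 2 + 2 * (2 * Y + 1) ^ 2 ≠ Z ^ 2 := by decide

/-- Squares modulo 8: `x² + u⁴ = 8v⁴` is impossible for odd `x, u`. [folklore] -/
private theorem zmod8_neg_sign : ∀ X U W : ZMod 8, (2 * X + 1) ^ 2 + (2 * U + 1) ^ 4 ≠ 8 * W := by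
  decide

/-- A common prime divisor argument: `IsCoprime` from "every prime dividing both is absurd".
[folklore] -/
private theorem isCoprime_of_prime_dvd {a b : ℤ}
    (H : ∀ p : ℕ, p.Prime → (p : ℤ) ∣ a → (p : ℤ) ∣ b → False) : IsCoprime a b := by
  rw [Int.isCoprime_iff_gcd_eq_one]
  by_contra hg
  obtain ⟨p, hp, hpg⟩ := Nat.exists_prime_and_dvd hg
  exact H p hp ((Int.natCast_dvd_natCast.mpr hpg).trans (Int.gcd_dvd_left ..))
    ((Int.natCast_dvd_natCast.mpr hpg).trans (Int.gcd_dvd_right ..))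

/-- The sign-free core of Cor. 6.3.14 (1): if `o·e = w²` with `gcd(o, e) = 1` and `o` odd, then
`o = ±s²`, `e = ±t²` with `gcd(s,t) = 1`, `s` odd, and `(o − 2e)² = (s² − 2t²)²`, `w² = (st)²`.
[cite: Cohen2007NumberTheoryI, Cor. 6.3.14 (1) (proof)] -/
theorem aux {o e w : ℤ} (hcop : IsCoprime o e) (hprod : o * e = w ^ 2) (ho : Odd o) :
    ∃ s t : ℤ, IsCoprime s t ∧ Odd s ∧ (o - 2 * e) ^ 2 = (s ^ 2 - 2 * t ^ 2) ^ 2 ∧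
      w ^ 2 = (s * t) ^ 2 := by
  obtain ⟨s, hs⟩ := Int.sq_of_isCoprime hcop hprod
  obtain ⟨t, ht⟩ := Int.sq_of_isCoprime hcop.symm (by rw [mul_comm]; exact hprod)
  have ho2 : o ^ 2 = s ^ 4 := by rcases hs with hs | hs <;> rw [hs] <;> ring
  have he2 : e ^ 2 = t ^ 4 := by rcases ht with ht | ht <;> rw [ht] <;> ring
  have hw2 : w ^ 2 = (s * t) ^ 2 := by
    have h4 : (w ^ 2) ^ 2 = ((s * t) ^ 2) ^ 2 := by
      rw [← hprod, mul_pow, ho2, he2]; ring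
    exact (pow_left_inj₀ (sq_nonneg _) (sq_nonneg _) two_ne_zero).mp h4
  have hsdvd : s ∣ o := by rcases hs with hs | hs <;> rw [hs]
    <;> [exact dvd_pow_self s two_ne_zero; exact (dvd_pow_self s two_ne_zero).neg_right]
  have htdvd : t ∣ e := by rcases ht with ht | ht <;> rw [ht]
    <;> [exact dvd_pow_self t two_ne_zero; exact (dvd_pow_self t two_ne_zero).neg_right]
  refine ⟨s, t, (hcop.of_isCoprime_of_dvd_left hsdvd).of_isCoprime_of_dvd_right htdvd, ?_, ?_, hw2⟩
  · have : Odd (s ^ 2) := by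
      rcases hs with hs | hs
      · exact hs ▸ ho
      · have := ho.neg; rw [hs, neg_neg] at this; exact this
    exact (Int.odd_pow' two_ne_zero).mp this
  · have e1 : (o - 2 * e) ^ 2 = o ^ 2 - 4 * (o * e) + 4 * e ^ 2 := by ring
    rw [e1, hprod, ho2, he2, hw2]; ring

/-- **Cohen, Cor. 6.3.14 (1), `p = 2` (the `x`, `y` components).** If `x² + 2y² = z²` with
`gcd(x, y) = 1` then there are coprime integers `s, t` with `s` odd, `x = ±(s² − 2t²)` and `y = 2st`.
[cite: Cohen2007NumberTheoryI, Cor. 6.3.14 (1)] -/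
theorem sq_add_two_sq_eq_sq {x y z : ℤ} (h : x ^ 2 + 2 * y ^ 2 = z ^ 2) (hxy : IsCoprime x y) :
    ∃ s t : ℤ, IsCoprime s t ∧ Odd s ∧ (x = s ^ 2 - 2 * t ^ 2 ∨ x = -(s ^ 2 - 2 * t ^ 2)) ∧
      y = 2 * s * t := by
  -- `y` even, `x` odd, `z` odd
  have hy : Even y := by
    rcases Int.even_or_odd y with hy | ⟨k, hk⟩
    · exact hy
    · exfalso
      have e := congrArg (Int.cast : ℤ → ZMod 8) h
      push_cast at e
      rw [hk] at e
      push_cast at e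
      exact zmod8_y_even _ _ _ e
  obtain ⟨w, hw⟩ := hy
  have hx : Odd x := by
    rcases Int.even_or_odd x with hx | hx
    · exfalso
      have h2 : (2 : ℤ) ∣ 1 := by
        obtain ⟨u, v, huv⟩ := hxy
        rw [← huv]
        exact dvd_add (dvd_mul_of_dvd_right (even_iff_two_dvd.mp hx) _)
          (dvd_mul_of_dvd_right ⟨w, by rw [hw]; ring⟩ _)
      norm_num at h2
    · exact hx
  have hz : Odd z := by
    have : Odd (z ^ 2) := by
      rw [← h]
      exact (hx.pow).add_even ⟨y ^ 2, by ring⟩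
    exact (Int.odd_pow' two_ne_zero).mp this
  -- `gcd(x, z) = 1`
  have hxz : IsCoprime x z := by
    refine isCoprime_of_prime_dvd fun p hp hpx hpz => ?_
    have hp' : Prime (p : ℤ) := Nat.prime_iff_prime_int.mp hp
    have h2y : (p : ℤ) ∣ 2 * y ^ 2 := by
      have e : 2 * y ^ 2 = z ^ 2 - x ^ 2 := by linear_combination h
      rw [e]; exact dvd_sub (dvd_pow hpz two_ne_zero) (dvd_pow hpx two_ne_zero)
    have hp2 : ¬ (p : ℤ) ∣ 2 := by
      intro h2
      have hp2' : p = 2 := (Nat.prime_dvd_prime_iff_eq hp Nat.prime_two).mp (by exact_mod_cast h2)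
      subst hp2'
      exact (Int.not_even_iff_odd.mpr hx) (even_iff_two_dvd.mpr (by exact_mod_cast hpx))
    have hpy : (p : ℤ) ∣ y := hp'.dvd_of_dvd_pow ((hp'.dvd_or_dvd h2y).resolve_left hp2)
    exact hp'.not_unit (hxy.isUnit_of_dvd' hpx hpy)
  -- `z - x = 2m`, `z + x = 2n`, `2 w² = m n`, `gcd(m, n) = 1`
  obtain ⟨m, hm⟩ : ∃ m, z - x = 2 * m := by
    obtain ⟨a, ha⟩ := hx; obtain ⟨b, hb⟩ := hz; exact ⟨b - a, by rw [ha, hb]; ring⟩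
  obtain ⟨n, hn⟩ : ∃ n, z + x = 2 * n := by
    obtain ⟨a, ha⟩ := hx; obtain ⟨b, hb⟩ := hz; exact ⟨a + b + 1, by rw [ha, hb]; ring⟩
  have hxmn : x = n - m := by linarith
  have hzmn : z = n + m := by linarith
  have hmn : m * n = 2 * w ^ 2 := by
    have e : (z - x) * (z + x) = 2 * y ^ 2 := by linear_combination -h
    rw [hm, hn, hw] at e
    exact mul_left_cancel₀ (show (4 : ℤ) ≠ 0 by norm_num) (by linear_combination e)
  have hcop : IsCoprime m n := by
    refine isCoprime_of_prime_dvd fun p hp hpm hpn => ?_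
    have hp' : Prime (p : ℤ) := Nat.prime_iff_prime_int.mp hp
    refine hp'.not_unit (hxz.isUnit_of_dvd' ?_ ?_)
    · rw [hxmn]; exact dvd_sub hpn hpm
    · rw [hzmn]; exact dvd_add hpn hpm
  -- one of `m`, `n` is even; the odd one is `±s²`, the half of the even one is `±t²`
  have h2mn : (2 : ℤ) ∣ m * n := ⟨w ^ 2, hmn⟩
  -- from the auxiliary lemma: `x² = (s² − 2t²)²`, `w² = (st)²`
  obtain ⟨s, t, hst, hs, hx2, hw2⟩ : ∃ s t : ℤ, IsCoprime s t ∧ Odd s ∧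
      x ^ 2 = (s ^ 2 - 2 * t ^ 2) ^ 2 ∧ w ^ 2 = (s * t) ^ 2 := by
    rcases Int.prime_two.dvd_or_dvd h2mn with ⟨m', hm'⟩ | ⟨n', hn'⟩
    · -- `m = 2m'`: odd one is `n`
      have hprod : n * m' = w ^ 2 := by
        have h1 := hmn; rw [hm'] at h1
        exact mul_left_cancel₀ (show (2 : ℤ) ≠ 0 by norm_num) (by linear_combination h1)
      have hcop' : IsCoprime n m' := (hcop.of_isCoprime_of_dvd_left ⟨2, by rw [hm']; ring⟩).symm
      have hnodd : Odd n := by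
        rcases Int.even_or_odd n with ⟨c, hc⟩ | ho
        · exfalso
          have : IsUnit (2 : ℤ) := hcop.isUnit_of_dvd' ⟨m', by rw [hm']⟩ ⟨c, by rw [hc]; ring⟩
          norm_num [Int.isUnit_iff] at this
        · exact ho
      obtain ⟨s, t, hst, hs, h1, h2⟩ := aux hcop' hprod hnodd
      refine ⟨s, t, hst, hs, ?_, h2⟩
      rw [← h1, hxmn, hm']
    · -- `n = 2n'`: odd one is `m`
      have hprod : m * n' = w ^ 2 := by
        have h1 := hmn; rw [hn'] at h1
        exact mul_left_cancel₀ (show (2 : ℤ) ≠ 0 by norm_num) (by linear_combination h1)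
      have hcop' : IsCoprime m n' := hcop.of_isCoprime_of_dvd_right ⟨2, by rw [hn']; ring⟩
      have hmodd : Odd m := by
        rcases Int.even_or_odd m with ⟨c, hc⟩ | ho
        · exfalso
          have : IsUnit (2 : ℤ) := hcop.isUnit_of_dvd' ⟨c, by rw [hc]; ring⟩ ⟨n', by rw [hn']⟩
          norm_num [Int.isUnit_iff] at this
        · exact ho
      obtain ⟨s, t, hst, hs, h1, h2⟩ := aux hcop' hprod hmodd
      refine ⟨s, t, hst, hs, ?_, h2⟩
      rw [← h1, hxmn, hn']; ring
  -- choose the sign of `t` so that `y = 2st`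
  rcases sq_eq_sq_iff_eq_or_eq_neg.mp hw2 with hw' | hw'
  · refine ⟨s, t, hst, hs, sq_eq_sq_iff_eq_or_eq_neg.mp hx2, ?_⟩
    rw [hw, hw']; ring
  · refine ⟨s, -t, hst.neg_right, hs, ?_, ?_⟩
    · have : s ^ 2 - 2 * (-t) ^ 2 = s ^ 2 - 2 * t ^ 2 := by ring
      rw [this]; exact sq_eq_sq_iff_eq_or_eq_neg.mp hx2
    · rw [hw, hw']; ring

/-- **Cohen, Prop. 6.5.4, coprime form with the descent made explicit:** there are no coprime `x, y`
with `y ≠ 0` and `x⁴ + 2y⁴ = z²` (strong induction on `|z|`). [cite: Cohen2007NumberTheoryI, Prop. 6.5.4] -/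
theorem quartic_add_two_quartic_ne_sq_of_isCoprime :
    ∀ (n : ℕ) (x y z : ℤ), z.natAbs = n → IsCoprime x y → y ≠ 0 → x ^ 4 + 2 * y ^ 4 ≠ z ^ 2 := by
  intro n
  induction n using Nat.strong_induction_on with
  | _ n IH =>
    intro x y z hn hxy hy0 h
    -- Step 1: `x² = ±(s² − 2t²)`, `y² = 2st`
    have h' : (x ^ 2) ^ 2 + 2 * (y ^ 2) ^ 2 = z ^ 2 := by linear_combination h
    obtain ⟨s, t, hst, hs, hx2, hy2⟩ := sq_add_two_sq_eq_sq h' hxy.pow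
    -- Step 2: `s = ±u²`, `t = ±2v²`
    have hs2t : IsCoprime s (2 * t) := (Int.isCoprime_two_left.mpr hs).symm.mul_right hst
    have hprod : s * (2 * t) = y ^ 2 := by linear_combination -hy2
    obtain ⟨u, hu⟩ := Int.sq_of_isCoprime hs2t hprod
    obtain ⟨q, hq⟩ := Int.sq_of_isCoprime hs2t.symm (by rw [mul_comm]; exact hprod)
    have hq2 : (2 : ℤ) ∣ q := by
      apply Int.prime_two.dvd_of_dvd_pow (n := 2)
      rcases hq with hq | hq
      · exact ⟨t, by linear_combination -hq⟩
      · exact ⟨-t, by linear_combination hq⟩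
    obtain ⟨v, hv⟩ := hq2
    have ht : t = 2 * v ^ 2 ∨ t = -(2 * v ^ 2) := by
      rcases hq with hq | hq
      · left; rw [hv] at hq; linarith
      · right; rw [hv] at hq; linarith
    have hs_sq : s ^ 2 = u ^ 4 := by rcases hu with hu | hu <;> rw [hu] <;> ring
    have ht_sq : t ^ 2 = 4 * v ^ 4 := by rcases ht with ht | ht <;> rw [ht] <;> ring
    have huodd : Odd u := by
      have : Odd (u ^ 2) := by
        rcases hu with hu | hu
        · exact hu ▸ hs
        · have := hs.neg; rw [hu, neg_neg] at this; exact this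
      exact (Int.odd_pow' two_ne_zero).mp this
    have hv0 : v ≠ 0 := by
      rintro rfl
      have ht0 : t = 0 := by rcases ht with ht | ht <;> rw [ht] <;> ring
      rw [ht0] at hy2
      exact hy0 (pow_eq_zero_iff (n := 2) two_ne_zero |>.mp (by rw [hy2]; ring))
    -- `y` even, so `x` odd
    have hxodd : Odd x := by
      rcases Int.even_or_odd x with hx | hx
      · exfalso
        have hy2' : (2 : ℤ) ∣ y := by
          apply Int.prime_two.dvd_of_dvd_pow (n := 2)
          exact ⟨s * t, by rw [hy2]; ring⟩
        have : IsUnit (2 : ℤ) := hxy.isUnit_of_dvd' (even_iff_two_dvd.mp hx) hy2'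
        norm_num [Int.isUnit_iff] at this
      · exact hx
    -- Step 3: the sign
    have hx2' : x ^ 2 = u ^ 4 - 8 * v ^ 4 ∨ x ^ 2 = -(u ^ 4 - 8 * v ^ 4) := by
      have e : s ^ 2 - 2 * t ^ 2 = u ^ 4 - 8 * v ^ 4 := by rw [hs_sq, ht_sq]; ring
      rw [← e]; exact hx2
    rcases hx2' with hplus | hminus
    swap
    · -- sign `−`: `x² + u⁴ = 8v⁴`, impossible mod 8
      obtain ⟨a, ha⟩ := hxodd
      obtain ⟨b, hb⟩ := huodd
      have e := congrArg (Int.cast : ℤ → ZMod 8) hminus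
      push_cast at e
      rw [ha, hb] at e
      push_cast at e
      exact zmod8_neg_sign a b (v ^ 4 : ℤ) (by push_cast; linear_combination e)
    · -- sign `+`: `x² + 2(2v²)² = (u²)²`
      have h2 : x ^ 2 + 2 * (2 * v ^ 2) ^ 2 = (u ^ 2) ^ 2 := by linear_combination hplus
      have hxv : IsCoprime x (2 * v ^ 2) := by
        refine ((Int.isCoprime_two_left.mpr hxodd).symm).mul_right (IsCoprime.pow_right ?_)
        refine isCoprime_of_prime_dvd fun p hp hpx hpv => ?_
        have hp' : Prime (p : ℤ) := Nat.prime_iff_prime_int.mp hp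
        have hpt : (p : ℤ) ∣ t := by
          rcases ht with ht | ht <;> rw [ht]
          · exact dvd_mul_of_dvd_right (dvd_pow hpv two_ne_zero) _
          · exact (dvd_mul_of_dvd_right (dvd_pow hpv two_ne_zero) _).neg_right
        have hps : (p : ℤ) ∣ s := by
          apply hp'.dvd_of_dvd_pow (n := 2)
          have e : s ^ 2 = x ^ 2 + 2 * t ^ 2 := by
            have e1 : x ^ 2 = s ^ 2 - 2 * t ^ 2 := by rw [hs_sq, ht_sq]; linear_combination hplus
            linear_combination -e1
          rw [e]
          exact dvd_add (dvd_pow hpx two_ne_zero) (dvd_mul_of_dvd_right (dvd_pow hpt two_ne_zero) _)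
        exact hp'.not_unit (hst.isUnit_of_dvd' hps hpt)
      obtain ⟨a, b, hab, ha, hxab, hvab⟩ := sq_add_two_sq_eq_sq h2 hxv
      have hvab' : v ^ 2 = a * b := by linarith
      -- `u² = a² + 2b²`
      have hu2 : u ^ 2 = a ^ 2 + 2 * b ^ 2 := by
        have e : (u ^ 2) ^ 2 = (a ^ 2 + 2 * b ^ 2) ^ 2 := by
          have hx2'' : x ^ 2 = (a ^ 2 - 2 * b ^ 2) ^ 2 := by
            rcases hxab with hx | hx
            · rw [hx]
            · rw [hx]; ring
          nlinarith [h2, hx2'', hvab']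
        exact (pow_left_inj₀ (sq_nonneg _) (by positivity) two_ne_zero).mp e
      -- `a = ±c²`, `b = ±d²`
      obtain ⟨c, hc⟩ := Int.sq_of_isCoprime hab hvab'.symm
      obtain ⟨d, hd⟩ := Int.sq_of_isCoprime hab.symm (by rw [mul_comm]; exact hvab'.symm)
      have ha2 : a ^ 2 = c ^ 4 := by rcases hc with hc | hc <;> rw [hc] <;> ring
      have hb2 : b ^ 2 = d ^ 4 := by rcases hd with hd | hd <;> rw [hd] <;> ring
      have hnew : c ^ 4 + 2 * d ^ 4 = u ^ 2 := by rw [hu2, ha2, hb2]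
      have hd0 : d ≠ 0 := by
        rintro rfl
        have hb0 : b = 0 := by rcases hd with hd | hd <;> rw [hd] <;> ring
        rw [hb0, mul_zero] at hvab'
        exact hv0 (pow_eq_zero_iff (n := 2) two_ne_zero |>.mp hvab')
      have hcd : IsCoprime c d := by
        have hca : c ∣ a := by
          rcases hc with hc | hc <;> rw [hc]
          · exact dvd_pow_self c two_ne_zero
          · exact (dvd_pow_self c two_ne_zero).neg_right
        have hdb : d ∣ b := by
          rcases hd with hd | hd <;> rw [hd]
          · exact dvd_pow_self d two_ne_zero
          · exact (dvd_pow_self d two_ne_zero).neg_right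
        exact (hab.of_isCoprime_of_dvd_left hca).of_isCoprime_of_dvd_right hdb
      -- `|u| < |z|`
      have hlt : u.natAbs < n := by
        rw [← hn, Int.natAbs_lt_iff_sq_lt]
        have hu0 : u ≠ 0 := by rintro rfl; exact (Int.not_even_iff_odd.mpr huodd) ⟨0, rfl⟩
        have hu1 : 1 ≤ u ^ 2 := by
          have := sq_nonneg u
          rcases this.lt_or_eq with hlt | heq
          · omega
          · exact absurd (pow_eq_zero_iff (n := 2) two_ne_zero |>.mp heq.symm) hu0
        have hv1 : 1 ≤ v ^ 2 := by
          have := sq_nonneg v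
          rcases this.lt_or_eq with hlt | heq
          · omega
          · exact absurd (pow_eq_zero_iff (n := 2) two_ne_zero |>.mp heq.symm) hv0
        have hy4 : y ^ 4 = 16 * u ^ 4 * v ^ 4 := by
          have : y ^ 4 = (y ^ 2) ^ 2 := by ring
          rw [this, hy2]
          have : (2 * s * t) ^ 2 = 4 * s ^ 2 * t ^ 2 := by ring
          rw [this, hs_sq, ht_sq]; ring
        have hv4 : 1 ≤ v ^ 4 := by nlinarith [hv1]
        have h1 : u ^ 2 ≤ u ^ 4 := by nlinarith [hu1]
        have h2 : u ^ 4 ≤ u ^ 4 * v ^ 4 := by nlinarith [hv4, sq_nonneg (u ^ 2)]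
        have h3 : 2 * y ^ 4 ≤ z ^ 2 := by nlinarith [sq_nonneg (x ^ 2), h]
        nlinarith [h1, h2, h3, hy4, hu1]
      exact IH _ hlt c d u rfl hcd hd0 hnew

/-- **Cohen, Prop. 6.5.4.** The Diophantine equation `x⁴ + 2y⁴ = z²` has no solution in integers
with `y ≠ 0`. [cite: Cohen2007NumberTheoryI, Prop. 6.5.4] -/
theorem quartic_add_two_quartic_ne_sq {x y z : ℤ} (hy : y ≠ 0) : x ^ 4 + 2 * y ^ 4 ≠ z ^ 2 := by
  intro h
  obtain ⟨g, x', y', hg, hcop, hx, hy'⟩ := Int.exists_gcd_one' (Int.gcd_pos_of_ne_zero_right x hy)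
  have hcop' : IsCoprime x' y' := Int.isCoprime_iff_gcd_eq_one.mpr hcop
  have hg0 : (g : ℤ) ≠ 0 := by exact_mod_cast hg.ne'
  have hy'0 : y' ≠ 0 := by rintro rfl; rw [zero_mul] at hy'; exact hy hy'
  -- `g⁴ ∣ z²`, so `g² ∣ z`
  have hgz : ((g : ℤ) ^ 2) ∣ z := by
    have h1 : ((g : ℤ) ^ 2) ^ 2 ∣ z ^ 2 := by
      rw [← h, hx, hy']
      exact ⟨x' ^ 4 + 2 * y' ^ 4, by ring⟩
    exact (Int.pow_dvd_pow_iff two_ne_zero).mp h1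
  obtain ⟨z', hz⟩ := hgz
  have h' : x' ^ 4 + 2 * y' ^ 4 = z' ^ 2 := by
    have e : (g : ℤ) ^ 4 * (x' ^ 4 + 2 * y' ^ 4) = (g : ℤ) ^ 4 * z' ^ 2 := by
      have h1 := h
      rw [hx, hy', hz] at h1
      linear_combination h1
    exact mul_left_cancel₀ (pow_ne_zero _ hg0) e
  exact quartic_add_two_quartic_ne_sq_of_isCoprime _ x' y' z' rfl hcop' hy'0 h'

end QuarticAddTwiceQuartic

end Literature.NumberTheory.DiophantineGeometry
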